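import Summits.ResolutionOfSingularities.ResolutionOfSingularities.Theorems.FrobeniusClosingPatchingRelPerfectTangentEuclidCharts
import HarnessLib

/-!
# Crux `PatchingRelPerfect` (stmt-ResolutionOfSingularities-16161), chain w52 — rung tool
# TANGENT EUCLID, part 4: the EXPLICIT tower for `K = (η t + c²) + (t^{β+1})`, EVERY `β`

[OURS · L1 W5.2 · rung tool, kernel (iii) support] Part 3 (`…TangentEuclidExplicit.lean`, p508825)
named the companion avatars of the tangent-Euclid shape `(t + c²) + (t²)` (`k = 2`, `β = 2`), the
finishing step of the cusp member `(x₃² + x₀³) + 𝔪⁴`.  The next members of the same family,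
`(x₃² + x₀³) + 𝔪^N`, end in the shape `(t + c²) + (t^{N-2})` on BOTH continuing charts (this seat's
note `NONGRADED-DEPTH4-MEMBER.md`, evidence #59 on the crux item: `N = 6`, depth four, 11 centres;
chart table kit j276688), and a kernel certificate needs the avatars BY NAME because one global
companion of `S` must serve every chart — the existential list of part 2
(`tangent_euclid_exponents`, p505269) is not enough.  This file names them for `k = 2` and EVERY
exponent of `t`:

* `CoreRungTower.tangent_euclid_two` — for `(t, c)` quasi-regular with `R/(t, c)` regular in a
  regular ring `R`, `η` a unit and any `β`, every blowing up of `Spec R` along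
  `((η t + c²) + (t^{β+1})) · ∏_{k < 2β} ((η t + c²) + (c^{k+2})) · (t, c)` is a regular scheme:
  blow up the tangency locus `V(t, c)`; on the `t`-chart everything is the Cartier divisor
  `(t^{2β+1})`; on the `c`-chart, with `h′ = η τ + c` (`t = c τ`), the residual is
  `c^{2β+1} · ∏_{k < 2β+1} ((h′) + (c^{k+1}))`, the `(2β+1)`-step tower of regular centres
  `V(h′) ∩ V(c)` (stub-1's `isRegular_of_isBlowup_tower`), i.e. Euclid `(1, 2β+1)` after the
  re-lettering `(c, h′)` of part 1.  `β = 1` is part 3 verbatim.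

FORMAT evidence / a tool for kernel-(iii) certificates (CHAIN v2.0 §1 (C)); nothing here is a
statement of the manuscript under review.

## References

* Q. Liu, *Algebraic Geometry and Arithmetic Curves*, OUP 2002, Thm. 8.1.19 (a). [Liu2002]
* The Stacks Project, Tags 080A, 080B, 0804, 0BIQ. [StacksProject]
-/

-- `Summit.<Summit>.<Sub>.Theorems` with `Sub = Summit` (single-conjunct summit, D-0017)
set_option linter.dupNamespace false

noncomputable section

open CategoryTheory CategoryTheory.Limits AlgebraicGeometry Literature.AlgebraicGeometry.Resolution

namespace Summit.ResolutionOfSingularities.ResolutionOfSingularities.Theorems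

universe u

namespace CoreRungTower

/-- Collecting a constant principal twist out of a finite product of ideals:
`∏_{k ∈ s} ((g) · A k) = (g ^ #s) · ∏_{k ∈ s} A k`. [folklore] -/
theorem prod_span_singleton_mul {A : Type*} [CommSemiring A] (g : A) (s : Finset ℕ)
    (B : ℕ → Ideal A) :
    ∏ k ∈ s, (Ideal.span {g} * B k) = Ideal.span {g ^ s.card} * ∏ k ∈ s, B k := by
  rw [Finset.prod_mul_distrib, Finset.prod_const, Ideal.span_singleton_pow]

/-- `Ideal.map` is multiplicative on finite products (via `Ideal.mapHom`). [folklore] -/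
theorem map_finsetProd' {A B : Type*} [CommRing A] [CommRing B] (φ : A →+* B) (s : Finset ℕ)
    (F : ℕ → Ideal A) :
    (∏ k ∈ s, F k).map φ = ∏ k ∈ s, (F k).map φ := by
  have h := map_prod (Ideal.mapHom φ) F s
  simpa only [Ideal.mapHom_apply] using h

set_option maxHeartbeats 400000 in
/-- **TANGENT EUCLID, EXPLICIT (`k = 2`, every `β`).** For `(t, c)` quasi-regular with `R/(t, c)`
a regular ring in a regular ring `R`, `η` a unit and `β : ℕ`, every blowing up of `Spec R` along
`((η t + c²) + (t^{β+1})) · ∏_{k < 2β} ((η t + c²) + (c^{k+2})) · (t, c)` is a regular scheme: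
blow up the tangency locus `V(t, c)`; on the `t`-chart everything is the Cartier divisor
`(t^{2β+1})`; on the `c`-chart, with `h′ = η τ + c` (`t = cτ`), the residual is
`c^{2β+1} · ∏_{k<2β+1} ((h′) + (c^{k+1}))`, the `(2β+1)`-step tower of regular centres
`V(h′) ∩ V(c)` (stub-1's `isRegular_of_isBlowup_tower`).  The avatars `(η t + c²) + (c^m)`,
`m = 2, …, 2β+1`, are named so that a member certificate can pull them back to `S`.
[cite: Liu2002, Thm. 8.1.19 (a)] [cite: StacksProject, Tag 080A] [cite: StacksProject, Tag 080B] -/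
theorem tangent_euclid_two (β : ℕ) {R : Type u} [CommRing R] [IsRegularRing R] (t c η : R)
    (hη : IsUnit η) (hx : IsQuasiRegular (![t, c] : Fin 2 → R))
    (hR : IsRegularRing (R ⧸ Ideal.span (Set.range (![t, c] : Fin 2 → R))))
    {Y : Scheme.{u}} {f : Y ⟶ Spec (.of R)}
    (hf : IsBlowup f (affineBlowup.idealSheaf
      (((Ideal.span {η * t + c ^ 2} ⊔ Ideal.span {t ^ (β + 1)}) *
        ∏ k ∈ Finset.range (2 * β), (Ideal.span {η * t + c ^ 2} ⊔ Ideal.span {c ^ (k + 2)})) *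
        Ideal.span (Set.range (![t, c] : Fin 2 → R))))) :
    Scheme.IsRegular Y := by
  haveI := hR
  -- the part-1 chart images, specialised to `k = 2`, and normalised
  have hK₁ : (Ideal.span {η * t + c ^ 2} ⊔ Ideal.span {t ^ (β + 1)}).map (chartBase (![t, c] : Fin 2 → R) 1) =
      Ideal.span {chartBase (![t, c] : Fin 2 → R) 1 c} * (Ideal.span {(chartBase (![t, c] : Fin 2 → R) 1 η * chartGen (![t, c] : Fin 2 → R) 1 0 + chartBase (![t, c] : Fin 2 → R) 1 c ^ 1)} ⊔ Ideal.span {chartBase (![t, c] : Fin 2 → R) 1 c ^ (2 * β + 1)}) := by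
    have h := map_chartBase_one_tangent t c η hη 1 β
    have e1 : η * t + c ^ (1 + 1) = η * t + c ^ 2 := by ring
    have e4 : ((1 + 1) * β + 1 : ℕ) = 2 * β + 1 := by ring
    rw [e1, e4] at h
    exact h
  have hF₁ : ∀ j : ℕ, (Ideal.span {η * t + c ^ 2} ⊔ Ideal.span {c ^ (1 + j)}).map (chartBase (![t, c] : Fin 2 → R) 1) =
      Ideal.span {chartBase (![t, c] : Fin 2 → R) 1 c ^ 1} * (Ideal.span {(chartBase (![t, c] : Fin 2 → R) 1 η * chartGen (![t, c] : Fin 2 → R) 1 0 + chartBase (![t, c] : Fin 2 → R) 1 c ^ 1)} ⊔ Ideal.span {chartBase (![t, c] : Fin 2 → R) 1 c ^ j}) := by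
    intro j
    have h := map_chartBase_one_tangentFactor t c η 1 1 j
    have e1 : η * t + c ^ (1 + 1) = η * t + c ^ 2 := by ring
    rw [e1, pow_one (Ideal.span {η * t + c ^ 2}),
      pow_one (Ideal.span {(chartBase (![t, c] : Fin 2 → R) 1 η * chartGen (![t, c] : Fin 2 → R) 1 0 + chartBase (![t, c] : Fin 2 → R) 1 c ^ 1)})] at h
    exact h
  have hK₀ : (Ideal.span {η * t + c ^ 2} ⊔ Ideal.span {t ^ (β + 1)}).map (chartBase (![t, c] : Fin 2 → R) 0) =
      Ideal.span {chartBase (![t, c] : Fin 2 → R) 0 t} := by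
    have h := map_chartBase_zero_tangent t c η hη 0 β
    have e1 : η * t + c ^ (0 + 1 + 1) = η * t + c ^ 2 := by ring
    rw [e1] at h
    exact h
  have hF₀ : ∀ j : ℕ, (Ideal.span {η * t + c ^ 2} ⊔ Ideal.span {c ^ (1 + j)}).map (chartBase (![t, c] : Fin 2 → R) 0) =
      Ideal.span {chartBase (![t, c] : Fin 2 → R) 0 t ^ 1} := by
    intro j
    have h := map_chartBase_zero_tangentFactor t c η hη 0 1 j
    have e1 : η * t + c ^ (0 + 1 + 1) = η * t + c ^ 2 := by ring
    rw [e1, pow_one (Ideal.span {η * t + c ^ 2})] at h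
    exact h
  -- the avatars as `(h) + (c^{1+j})`
  have havatar : ∀ k : ℕ, Ideal.span {η * t + c ^ 2} ⊔ Ideal.span {c ^ (k + 2)} =
      Ideal.span {η * t + c ^ 2} ⊔ Ideal.span {c ^ (1 + (k + 1))} := by
    intro k
    have e : k + 2 = 1 + (k + 1) := by ring
    rw [e]
  simp only [havatar] at hf
  refine isRegular_of_isBlowup_mul_of_charts (![t, c] : Fin 2 → R) _ (fun i => ?_) hf
  have hi : i = 0 ∨ i = 1 := by
    fin_cases i
    · exact Or.inl rfl
    · exact Or.inr rfl
  rcases hi with rfl | rfl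
  · -- the `t`-chart: everything is the Cartier divisor `(t^{2β+1})`
    intro Y' ρ hρ
    haveI hB : IsRegularRing (chartRing (![t, c] : Fin 2 → R) 0) := isRegularRing_blowupChart _ 0 hx
    have hti : chartBase (![t, c] : Fin 2 → R) 0 t ∈ nonZeroDivisors (chartRing (![t, c] : Fin 2 → R) 0) :=
      reesChartBase_mem_nonZeroDivisors ((![t, c] : Fin 2 → R) 0)
        (Ideal.mem_span_range_self (f := (![t, c] : Fin 2 → R)) (x := 0))
    rw [Ideal.map_mul, map_finsetProd', hK₀] at hρ
    simp only [hF₀] at hρ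
    rw [Finset.prod_const, Finset.card_range, Ideal.span_singleton_pow,
      Ideal.span_singleton_mul_span_singleton] at hρ
    have hρ2 : IsBlowup ρ (affineBlowup.idealSheaf
        (Ideal.span {chartBase (![t, c] : Fin 2 → R) 0 t * (chartBase (![t, c] : Fin 2 → R) 0 t ^ 1) ^ (2 * β)} * ⊤)) := by
      rwa [Ideal.mul_top]
    refine CoreRungTower.isRegular_of_isBlowup_span_singleton_mul
      (mul_mem hti (pow_mem (pow_mem hti 1) _)) _ (fun Y'' ρ' hρ' => ?_) hρ2
    rw [affineBlowup.idealSheaf_top] at hρ'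
    haveI : IsIso ρ' := hρ'.isIso isEffectiveCartier_top
    haveI : IsRegularRing (CommRingCat.of (chartRing (![t, c] : Fin 2 → R) 0)) := hB
    exact SectionAscent.TraceIdeal.isRegular_of_iso (asIso ρ') (Scheme.isRegular_Spec _)
  · -- the `c`-chart: re-letter `(c, h′)`, `h′ = η τ + c`, and run the `(2β+1)`-step tower
    intro Y' ρ hρ
    haveI hB : IsRegularRing (chartRing (![t, c] : Fin 2 → R) 1) := isRegularRing_blowupChart _ 1 hx
    have hci : chartBase (![t, c] : Fin 2 → R) 1 c ∈ nonZeroDivisors (chartRing (![t, c] : Fin 2 → R) 1) :=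
      reesChartBase_mem_nonZeroDivisors ((![t, c] : Fin 2 → R) 1)
        (Ideal.mem_span_range_self (f := (![t, c] : Fin 2 → R)) (x := 1))
    rw [Ideal.map_mul, map_finsetProd', hK₁] at hρ
    simp only [hF₁] at hρ
    -- name the tower factors `B k = (h′) + (c^{k+1})`
    obtain ⟨B, hB'⟩ : ∃ B : ℕ → Ideal (chartRing (![t, c] : Fin 2 → R) 1),
        B = fun k => Ideal.span {(chartBase (![t, c] : Fin 2 → R) 1 η * chartGen (![t, c] : Fin 2 → R) 1 0 + chartBase (![t, c] : Fin 2 → R) 1 c ^ 1)} ⊔ Ideal.span {chartBase (![t, c] : Fin 2 → R) 1 c ^ (k + 1)} := ⟨_, rfl⟩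
    have hBk : ∀ k : ℕ, Ideal.span {(chartBase (![t, c] : Fin 2 → R) 1 η * chartGen (![t, c] : Fin 2 → R) 1 0 + chartBase (![t, c] : Fin 2 → R) 1 c ^ 1)} ⊔ Ideal.span {chartBase (![t, c] : Fin 2 → R) 1 c ^ (k + 1)} = B k := by
      intro k; rw [hB']
    simp only [hBk] at hρ
    -- collect the Cartier twist and append the `K`-factor to the product of avatars
    have hprod : Ideal.span {chartBase (![t, c] : Fin 2 → R) 1 c} * B (2 * β) *
        ∏ k ∈ Finset.range (2 * β), (Ideal.span {chartBase (![t, c] : Fin 2 → R) 1 c ^ 1} * B k) =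
        Ideal.span {chartBase (![t, c] : Fin 2 → R) 1 c * (chartBase (![t, c] : Fin 2 → R) 1 c ^ 1) ^ (2 * β)} * ∏ k ∈ Finset.range (2 * β + 1), B k := by
      rw [prod_span_singleton_mul, Finset.card_range, Finset.prod_range_succ,
        ← Ideal.span_singleton_mul_span_singleton]
      ring
    rw [hprod] at hρ
    refine CoreRungTower.isRegular_of_isBlowup_span_singleton_mul
      (mul_mem hci (pow_mem (pow_mem hci 1) _)) _ (fun Y'' ρ' hρ' => ?_) hρ
    -- the tower for `x' = (c, h′)`, `P' = (h′)`
    have hx' : IsQuasiRegular (Fin.cons (chartBase (![t, c] : Fin 2 → R) 1 c) (fun _ : Fin 1 => (chartBase (![t, c] : Fin 2 → R) 1 η * chartGen (![t, c] : Fin 2 → R) 1 0 + chartBase (![t, c] : Fin 2 → R) 1 c ^ 1)) :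
        Fin 2 → chartRing (![t, c] : Fin 2 → R) 1) := by
      have h := isWeaklyRegular_exc_strict t c η hη hx 0
      rw [Nat.zero_add] at h
      exact isQuasiRegular_of_isWeaklyRegular _ h
    have hR' : IsRegularRing (chartRing (![t, c] : Fin 2 → R) 1 ⧸ Ideal.span (Set.range
        (Fin.cons (chartBase (![t, c] : Fin 2 → R) 1 c) (fun _ : Fin 1 => (chartBase (![t, c] : Fin 2 → R) 1 η * chartGen (![t, c] : Fin 2 → R) 1 0 + chartBase (![t, c] : Fin 2 → R) 1 c ^ 1)) : Fin 2 → chartRing (![t, c] : Fin 2 → R) 1))) := by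
      have h := isRegularRing_quot_exc_strict t c η hη hx 0
      rw [Nat.zero_add] at h
      exact h
    have hP : Ideal.span (Set.range ((Fin.cons (chartBase (![t, c] : Fin 2 → R) 1 c) (fun _ : Fin 1 => (chartBase (![t, c] : Fin 2 → R) 1 η * chartGen (![t, c] : Fin 2 → R) 1 0 + chartBase (![t, c] : Fin 2 → R) 1 c ^ 1)) :
        Fin 2 → chartRing (![t, c] : Fin 2 → R) 1) ∘ (fun _ : Fin 1 => (1 : Fin 2)))) = Ideal.span {(chartBase (![t, c] : Fin 2 → R) 1 η * chartGen (![t, c] : Fin 2 → R) 1 0 + chartBase (![t, c] : Fin 2 → R) 1 c ^ 1)} := by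
      have hr : Set.range ((Fin.cons (chartBase (![t, c] : Fin 2 → R) 1 c) (fun _ : Fin 1 => (chartBase (![t, c] : Fin 2 → R) 1 η * chartGen (![t, c] : Fin 2 → R) 1 0 + chartBase (![t, c] : Fin 2 → R) 1 c ^ 1)) :
          Fin 2 → chartRing (![t, c] : Fin 2 → R) 1) ∘ (fun _ : Fin 1 => (1 : Fin 2))) = {(chartBase (![t, c] : Fin 2 → R) 1 η * chartGen (![t, c] : Fin 2 → R) 1 0 + chartBase (![t, c] : Fin 2 → R) 1 c ^ 1)} := by
        ext y
        simp only [Set.mem_range, Function.comp_apply, Set.mem_singleton_iff]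
        constructor
        · rintro ⟨_, rfl⟩; rfl
        · rintro rfl; exact ⟨0, rfl⟩
      rw [hr]
    have hM : Ideal.span (Set.range (Fin.cons (chartBase (![t, c] : Fin 2 → R) 1 c) (fun _ : Fin 1 => (chartBase (![t, c] : Fin 2 → R) 1 η * chartGen (![t, c] : Fin 2 → R) 1 0 + chartBase (![t, c] : Fin 2 → R) 1 c ^ 1)) :
        Fin 2 → chartRing (![t, c] : Fin 2 → R) 1)) = Ideal.span {(chartBase (![t, c] : Fin 2 → R) 1 η * chartGen (![t, c] : Fin 2 → R) 1 0 + chartBase (![t, c] : Fin 2 → R) 1 c ^ 1)} ⊔ Ideal.span {chartBase (![t, c] : Fin 2 → R) 1 c} := by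
      rw [Fin.range_cons, Set.range_const, Ideal.span_insert, sup_comm]
    have htower := isRegular_of_isBlowup_tower (2 * β + 1) (Fin.cons (chartBase (![t, c] : Fin 2 → R) 1 c) (fun _ : Fin 1 => (chartBase (![t, c] : Fin 2 → R) 1 η * chartGen (![t, c] : Fin 2 → R) 1 0 + chartBase (![t, c] : Fin 2 → R) 1 c ^ 1)) :
        Fin 2 → chartRing (![t, c] : Fin 2 → R) 1) (fun _ : Fin 1 => (1 : Fin 2))
      (fun a b _ => Subsingleton.elim a b) hx' hR' (Y := Y'') (f := ρ')
    rw [hP] at htower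
    have hcongr : ∏ k ∈ Finset.range (2 * β + 1), (Ideal.span {(chartBase (![t, c] : Fin 2 → R) 1 η * chartGen (![t, c] : Fin 2 → R) 1 0 + chartBase (![t, c] : Fin 2 → R) 1 c ^ 1)} ⊔ Ideal.span (Set.range
        (Fin.cons (chartBase (![t, c] : Fin 2 → R) 1 c) (fun _ : Fin 1 => (chartBase (![t, c] : Fin 2 → R) 1 η * chartGen (![t, c] : Fin 2 → R) 1 0 + chartBase (![t, c] : Fin 2 → R) 1 c ^ 1)) : Fin 2 → chartRing (![t, c] : Fin 2 → R) 1)) ^ (k + 1)) =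
        ∏ k ∈ Finset.range (2 * β + 1), B k := by
      refine Finset.prod_congr rfl (fun k _ => ?_)
      rw [sup_pow_eq_sup_span_singleton_pow hM (k + 1), hBk]
    rw [hcongr] at htower
    exact htower hρ'

end CoreRungTower

end Summit.ResolutionOfSingularities.ResolutionOfSingularities.Theorems

end
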